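import Summits.AnomalousDissipation.AnomalousDissipation.Theorems.SawtoothPulseCascadeK1LocalisedCascadeSlotFibreSum

/-!
# K1loc, line `Spectral` / SeqCone — helper: THE PER-FIBRE TWO-STRIP ESTIMATE BY UN-GAUGING (T1, brick 3b)

Helper file of the prover lane on the crux `K1LocalisedCascade` (stmt-AnomalousDissipation-19491), route
`SawtoothPulseCascade` (memo v4 §3, target T1).  `…SlotFibreSum` sums an ABSTRACT per-fibre two-strip estimate over the
fibres; here the per-fibre estimate is discharged by un-gauging (`ungauge_fibre_eq`, `…SlotUngauge`) and the two-branch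
step with its cross term discharged (`tsum_symbol_sq_twoBranch_le`, `…SlotTwoBranch`), the commutator errors being the
`ω`- and `ω₂`-moments of the un-gauging multipliers `Θ^±_n = X^±(x_j) g_n(x_j) e_{b^±_n e_j}`:
`tsum_symbol_sq_twoStrip_fibre_le` (one fibre) and `tsum_symbol_sq_twoStrip_le_of_band` (band-limited `θ`, uniform moment
bounds).  (A sharper per-fibre analysis — higher-order symbolic expansion of the commutator, needed when `2ρ_N² > γ²` —
plugs into the same abstract assembly.)  No definitions; no statement about the stub.
[cite: Grafakos2014, Prop. 3.1.2 (5) (coefficients of products, translations and modulations) and Prop. 3.2.7 (3)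
(Parseval)] [problem: turb]
-/

-- `Summit.<Summit>.<Problem>`: single-conjunct summit, the duplicate namespace segment is deliberate.
set_option linter.dupNamespace false

noncomputable section

namespace Summit.AnomalousDissipation.AnomalousDissipation.Theorems.SawtoothPulseCascade.K1Slot

open MeasureTheory Set Filter Topology UnitAddTorus Function
open scoped ComplexConjugate
open Literature.Analysis Literature.Analysis.FunctionSpaces Literature.Analysis.FunctionSpaces.Torus
open Summit.AnomalousDissipation.AnomalousDissipation.Theorems.SawtoothPulseCascade.SpectralLeakage

variable {d : Type*} [Fintype d] [DecidableEq d]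

/-! ## Discharging the per-fibre estimate by un-gauging and the two-branch step -/

/-- **The per-fibre two-strip estimate by un-gauging** (one fibre `k_i = n`): for a smooth `G` with modes on the fibre,
disjoint cut-offs `X^±` (`|X^±| ≤ 1`, `X⁺X⁻ = 0`), a symbol `m_n` agreeing with `m` on the fibre (`|m_n| ≤ M`) with moduli
`ω_n` (for `m_n`) and `ω₂,ₙ` (for `m_n²`), the un-gauging multipliers `Θ^± = X^±(x_j) g_n(x_j) e_{b^± e_j}` having finite
`ω_n`- and `ω₂,ₙ`-moments:
`Σ' m²|𝓕((X⁺+X⁻)(x_j)·(G∘Φ))|² ≤ (√Σ' m(k−b⁺e_j)²|𝓕G|² + (Σω_n|𝓕Θ⁺|)‖G‖)² + (√Σ' m(k−b⁻e_j)²|𝓕G|² + (Σω_n|𝓕Θ⁻|)‖G‖)²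
  + 2(Σω₂,ₙ|𝓕Θ⁺|)‖G‖²` (`ungauge_fibre_eq` and `tsum_symbol_sq_twoBranch_le`).
[cite: Grafakos2014, Prop. 3.1.2 (5) and Prop. 3.2.7 (3)] -/
theorem tsum_symbol_sq_twoStrip_fibre_le {G : UnitAddTorus d → ℂ} {i j : d} (hG : IsSmooth G) (hij : i ≠ j) {n : ℤ}
    (hn : ∀ k, mFourierCoeff G k ≠ 0 → k i = n) (P Xp Xm : ShearProfile) (hXp1 : ∀ y, |Xp y| ≤ 1)
    (hXm1 : ∀ y, |Xm y| ≤ 1) (hdis : ∀ y, Xp y * Xm y = 0) (bp bm : ℤ) {m : (d → ℤ) → ℝ}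
    {mn : (d → ℤ) → ℝ} (hmn : ∀ k, k i = n → mn k = m k) {M : ℝ} (hmnM : ∀ k, |mn k| ≤ M)
    {ωn ω₂n : (d → ℤ) → ℝ} (hω0 : ∀ q, 0 ≤ ωn q) (hω : ∀ k q, |mn k - mn (k - q)| ≤ ωn q) (hω₂0 : ∀ q, 0 ≤ ω₂n q)
    (hω₂ : ∀ k q, |mn k ^ 2 - mn (k - q) ^ 2| ≤ ω₂n q)
    (hωp : Summable fun q => ωn q *
      ‖mFourierCoeff (fun x : UnitAddTorus d => (Xp.onCircle (x j) : ℂ) * twist P n (x j) * mFourier (Pi.single j bp) x) q‖)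
    (hωm : Summable fun q => ωn q *
      ‖mFourierCoeff (fun x : UnitAddTorus d => (Xm.onCircle (x j) : ℂ) * twist P n (x j) * mFourier (Pi.single j bm) x) q‖)
    (hω₂p : Summable fun q => ω₂n q *
      ‖mFourierCoeff (fun x : UnitAddTorus d => (Xp.onCircle (x j) : ℂ) * twist P n (x j) * mFourier (Pi.single j bp) x) q‖) :
    ∑' k, m k ^ 2 * ‖mFourierCoeff (fun x => ((Xp.onCircle (x j) : ℂ) + Xm.onCircle (x j)) * G (shearMap i j P x)) k‖ ^ 2 ≤
      (Real.sqrt (∑' k, m (k - Pi.single j bp) ^ 2 * ‖mFourierCoeff G k‖ ^ 2) +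
          (∑' q, ωn q * ‖mFourierCoeff (fun x : UnitAddTorus d =>
            (Xp.onCircle (x j) : ℂ) * twist P n (x j) * mFourier (Pi.single j bp) x) q‖) * Real.sqrt (∫ x, ‖G x‖ ^ 2)) ^ 2 +
        (Real.sqrt (∑' k, m (k - Pi.single j bm) ^ 2 * ‖mFourierCoeff G k‖ ^ 2) +
          (∑' q, ωn q * ‖mFourierCoeff (fun x : UnitAddTorus d =>
            (Xm.onCircle (x j) : ℂ) * twist P n (x j) * mFourier (Pi.single j bm) x) q‖) * Real.sqrt (∫ x, ‖G x‖ ^ 2)) ^ 2 +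
        2 * ((∑' q, ω₂n q * ‖mFourierCoeff (fun x : UnitAddTorus d =>
            (Xp.onCircle (x j) : ℂ) * twist P n (x j) * mFourier (Pi.single j bp) x) q‖) * ∫ x, ‖G x‖ ^ 2) := by
  -- the multipliers
  set Θp : UnitAddTorus d → ℂ := fun x => (Xp.onCircle (x j) : ℂ) * twist P n (x j) * mFourier (Pi.single j bp) x
    with hΘp_def
  set Θm : UnitAddTorus d → ℂ := fun x => (Xm.onCircle (x j) : ℂ) * twist P n (x j) * mFourier (Pi.single j bm) x
    with hΘm_def
  have hΘp_smooth : IsSmooth Θp := isSmooth_ungaugeMultiplier P Xp n j bp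
  have hΘm_smooth : IsSmooth Θm := isSmooth_ungaugeMultiplier P Xm n j bm
  have hΘp1 : ∀ x, ‖Θp x‖ ≤ 1 := fun x => norm_ungaugeMultiplier_le P Xp hXp1 n j bp x
  have hΘm1 : ∀ x, ‖Θm x‖ ≤ 1 := fun x => norm_ungaugeMultiplier_le P Xm hXm1 n j bm x
  have hΘdis : ∀ x, conj (Θp x) * Θm x = 0 := fun x => conj_ungaugeMultiplier_mul_eq_zero P hdis n j bp bm x
  -- un-gauge both strips
  have hsplit : (fun x => ((Xp.onCircle (x j) : ℂ) + Xm.onCircle (x j)) * G (shearMap i j P x)) =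
      fun x => mFourier (Pi.single j (-bp)) x * (Θp x * G x) + mFourier (Pi.single j (-bm)) x * (Θm x * G x) := by
    have hp := ungauge_fibre_eq hG hn P Xp j bp
    have hm := ungauge_fibre_eq hG hn P Xm j bm
    funext x
    have hp' := congrFun hp x
    have hm' := congrFun hm x
    simp only [Function.comp_apply] at hp' hm'
    simp only [hΘp_def, hΘm_def, add_mul]
    rw [hp', hm']
  have h2 := tsum_symbol_sq_twoBranch_le (F := G) (Ξp := Θp) (Ξm := Θm) hG.continuous
    hG.rapidDecay_mFourierCoeff.summable_norm hΘp_smooth.continuous hΘp_smooth.rapidDecay_mFourierCoeff.summable_norm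
    hΘp1 hΘm_smooth.continuous hΘm_smooth.rapidDecay_mFourierCoeff.summable_norm hΘm1 hΘdis (Pi.single j (-bp))
    (Pi.single j (-bm)) hmnM hω0 hω hωp hωm hω₂0 hω₂ hω₂p
  -- symbol conversions (everything lives on the fibre `k_i = n`)
  have hH_supp : ∀ k, mFourierCoeff (fun x => ((Xp.onCircle (x j) : ℂ) + Xm.onCircle (x j)) * G (shearMap i j P x)) k ≠ 0 →
      k i = n := by
    intro k hk
    by_contra h
    have hΞ_inv : ∀ (t : UnitAddCircle) (x : UnitAddTorus d),
        ((Xp.onCircle ((x + Pi.single i t : UnitAddTorus d) j) : ℂ) +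
            Xm.onCircle ((x + Pi.single i t : UnitAddTorus d) j)) =
          (Xp.onCircle (x j) : ℂ) + Xm.onCircle (x j) := fun t x => by
      simp [Pi.single_eq_of_ne hij.symm]
    have hψ_supp : ∀ k, mFourierCoeff (G ∘ shearMap i j P) k ≠ 0 → k i = n := by
      intro k' hk'
      by_contra h'
      exact hk' (mFourierCoeff_comp_shearMap_eq_zero_of_apply_not_mem hG.continuous
        hG.rapidDecay_mFourierCoeff.summable_norm hij P (A := {n}) (fun k'' hk'' => not_not.1 fun h'' => hk'' (hn k'' h'')) h')
    exact hk (mFourierCoeff_mul_eq_zero_of_fibre (θ := G ∘ shearMap i j P) hΞ_inv (hG.comp_shearMap i j P) hψ_supp h)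
  have hL : ∑' k, mn k ^ 2 * ‖mFourierCoeff (fun x => ((Xp.onCircle (x j) : ℂ) + Xm.onCircle (x j)) *
      G (shearMap i j P x)) k‖ ^ 2 = ∑' k, m k ^ 2 * ‖mFourierCoeff (fun x => ((Xp.onCircle (x j) : ℂ) + Xm.onCircle (x j)) *
      G (shearMap i j P x)) k‖ ^ 2 :=
    tsum_symbol_sq_congr_of_supp fun k hk => by rw [hmn k (hH_supp k hk)]
  have hshift : ∀ (b : ℤ) (k : d → ℤ), k i = n → mn (k + Pi.single j (-b)) = m (k - Pi.single j b) := by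
    intro b k hk
    rw [Pi.single_neg, ← sub_eq_add_neg]
    exact hmn _ (by rw [Pi.sub_apply, Pi.single_eq_of_ne hij, sub_zero, hk])
  have hRp : ∑' k, mn (k + Pi.single j (-bp)) ^ 2 * ‖mFourierCoeff G k‖ ^ 2 =
      ∑' k, m (k - Pi.single j bp) ^ 2 * ‖mFourierCoeff G k‖ ^ 2 :=
    tsum_symbol_sq_congr_of_supp fun k hk => by rw [hshift bp k (hn k hk)]
  have hRm : ∑' k, mn (k + Pi.single j (-bm)) ^ 2 * ‖mFourierCoeff G k‖ ^ 2 =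
      ∑' k, m (k - Pi.single j bm) ^ 2 * ‖mFourierCoeff G k‖ ^ 2 :=
    tsum_symbol_sq_congr_of_supp fun k hk => by rw [hshift bm k (hn k hk)]
  rw [hsplit] at hL ⊢
  rw [← hL, ← hRp, ← hRm]
  exact h2

/-- **Un-gauging the two flat-strip families, band-limited case** (the per-fibre estimate discharged by
`tsum_symbol_sq_twoStrip_fibre_le` with uniform moment bounds `A⁺, A⁻, C` over the fibres `n ∈ s`).
TODO(general form): smooth `θ` without band limitation, by truncation (as in `…KoopmanLeakageFull`).
[cite: Grafakos2014, Prop. 3.1.2 (5) and Prop. 3.2.7 (3)] -/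
theorem tsum_symbol_sq_twoStrip_le_of_band {θ : UnitAddTorus d → ℂ} {i j : d} (hθ : IsSmooth θ) (hij : i ≠ j)
    (s : Finset ℤ) (hband : ∀ k, mFourierCoeff θ k ≠ 0 → k i ∈ s) (P Xp Xm : ShearProfile)
    (hXp1 : ∀ y, |Xp y| ≤ 1) (hXm1 : ∀ y, |Xm y| ≤ 1) (hdis : ∀ y, Xp y * Xm y = 0) (bp bm : ℤ → ℤ)
    {m : (d → ℤ) → ℝ} {M : ℝ} (hmM : ∀ k, |m k| ≤ M)
    {mf : ℤ → (d → ℤ) → ℝ} (hmf : ∀ n k, k i = n → mf n k = m k) (hmfM : ∀ n k, |mf n k| ≤ M)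
    {ω ω₂ : ℤ → (d → ℤ) → ℝ} (hω0 : ∀ n q, 0 ≤ ω n q) (hω : ∀ n k q, |mf n k - mf n (k - q)| ≤ ω n q)
    (hω₂0 : ∀ n q, 0 ≤ ω₂ n q) (hω₂ : ∀ n k q, |mf n k ^ 2 - mf n (k - q) ^ 2| ≤ ω₂ n q)
    (hωp : ∀ n ∈ s, Summable fun q => ω n q *
      ‖mFourierCoeff (fun x : UnitAddTorus d => (Xp.onCircle (x j) : ℂ) * twist P n (x j) * mFourier (Pi.single j (bp n)) x) q‖)
    (hωm : ∀ n ∈ s, Summable fun q => ω n q *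
      ‖mFourierCoeff (fun x : UnitAddTorus d => (Xm.onCircle (x j) : ℂ) * twist P n (x j) * mFourier (Pi.single j (bm n)) x) q‖)
    (hω₂p : ∀ n ∈ s, Summable fun q => ω₂ n q *
      ‖mFourierCoeff (fun x : UnitAddTorus d => (Xp.onCircle (x j) : ℂ) * twist P n (x j) * mFourier (Pi.single j (bp n)) x) q‖)
    {Ap Am C : ℝ} (hAp0 : 0 ≤ Ap) (hAm0 : 0 ≤ Am)
    (hAp : ∀ n ∈ s, ∑' q, ω n q *
      ‖mFourierCoeff (fun x : UnitAddTorus d => (Xp.onCircle (x j) : ℂ) * twist P n (x j) * mFourier (Pi.single j (bp n)) x) q‖ ≤ Ap)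
    (hAm : ∀ n ∈ s, ∑' q, ω n q *
      ‖mFourierCoeff (fun x : UnitAddTorus d => (Xm.onCircle (x j) : ℂ) * twist P n (x j) * mFourier (Pi.single j (bm n)) x) q‖ ≤ Am)
    (hC : ∀ n ∈ s, ∑' q, ω₂ n q *
      ‖mFourierCoeff (fun x : UnitAddTorus d => (Xp.onCircle (x j) : ℂ) * twist P n (x j) * mFourier (Pi.single j (bp n)) x) q‖ ≤ C) :
    ∑' k, m k ^ 2 * ‖mFourierCoeff (fun x => ((Xp.onCircle (x j) : ℂ) + Xm.onCircle (x j)) * θ (shearMap i j P x)) k‖ ^ 2 ≤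
      (Real.sqrt (∑' k, m (k - Pi.single j (bp (k i))) ^ 2 * ‖mFourierCoeff θ k‖ ^ 2) + Ap * Real.sqrt (∫ x, ‖θ x‖ ^ 2)) ^ 2 +
        (Real.sqrt (∑' k, m (k - Pi.single j (bm (k i))) ^ 2 * ‖mFourierCoeff θ k‖ ^ 2) + Am * Real.sqrt (∫ x, ‖θ x‖ ^ 2)) ^ 2 +
        2 * C * ∫ x, ‖θ x‖ ^ 2 := by
  refine tsum_symbol_sq_twoStrip_le_of_band_of_fibre hθ hij s hband P Xp Xm bp bm hmM hAp0 hAm0 fun n hn G hG hGn => ?_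
  have h := tsum_symbol_sq_twoStrip_fibre_le hG hij hGn P Xp Xm hXp1 hXm1 hdis (bp n) (bm n) (hmf n) (hmfM n) (hω0 n)
    (hω n) (hω₂0 n) (hω₂ n) (hωp n hn) (hωm n hn) (hω₂p n hn)
  have hg0 : 0 ≤ Real.sqrt (∫ x, ‖G x‖ ^ 2) := Real.sqrt_nonneg _
  have hSp0 : 0 ≤ ∑' q, ω n q * ‖mFourierCoeff (fun x : UnitAddTorus d =>
      (Xp.onCircle (x j) : ℂ) * twist P n (x j) * mFourier (Pi.single j (bp n)) x) q‖ :=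
    tsum_nonneg fun q => mul_nonneg (hω0 n q) (norm_nonneg _)
  have hSm0 : 0 ≤ ∑' q, ω n q * ‖mFourierCoeff (fun x : UnitAddTorus d =>
      (Xm.onCircle (x j) : ℂ) * twist P n (x j) * mFourier (Pi.single j (bm n)) x) q‖ :=
    tsum_nonneg fun q => mul_nonneg (hω0 n q) (norm_nonneg _)
  have h1p : (Real.sqrt (∑' k, m (k - Pi.single j (bp n)) ^ 2 * ‖mFourierCoeff G k‖ ^ 2) +
      (∑' q, ω n q * ‖mFourierCoeff (fun x : UnitAddTorus d =>
        (Xp.onCircle (x j) : ℂ) * twist P n (x j) * mFourier (Pi.single j (bp n)) x) q‖) * Real.sqrt (∫ x, ‖G x‖ ^ 2)) ^ 2 ≤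
      (Real.sqrt (∑' k, m (k - Pi.single j (bp n)) ^ 2 * ‖mFourierCoeff G k‖ ^ 2) + Ap * Real.sqrt (∫ x, ‖G x‖ ^ 2)) ^ 2 :=
    pow_le_pow_left₀ (add_nonneg (Real.sqrt_nonneg _) (mul_nonneg hSp0 hg0))
      (add_le_add le_rfl (mul_le_mul_of_nonneg_right (hAp n hn) hg0)) 2
  have h1m : (Real.sqrt (∑' k, m (k - Pi.single j (bm n)) ^ 2 * ‖mFourierCoeff G k‖ ^ 2) +
      (∑' q, ω n q * ‖mFourierCoeff (fun x : UnitAddTorus d =>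
        (Xm.onCircle (x j) : ℂ) * twist P n (x j) * mFourier (Pi.single j (bm n)) x) q‖) * Real.sqrt (∫ x, ‖G x‖ ^ 2)) ^ 2 ≤
      (Real.sqrt (∑' k, m (k - Pi.single j (bm n)) ^ 2 * ‖mFourierCoeff G k‖ ^ 2) + Am * Real.sqrt (∫ x, ‖G x‖ ^ 2)) ^ 2 :=
    pow_le_pow_left₀ (add_nonneg (Real.sqrt_nonneg _) (mul_nonneg hSm0 hg0))
      (add_le_add le_rfl (mul_le_mul_of_nonneg_right (hAm n hn) hg0)) 2
  have h1c : 2 * ((∑' q, ω₂ n q * ‖mFourierCoeff (fun x : UnitAddTorus d =>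
      (Xp.onCircle (x j) : ℂ) * twist P n (x j) * mFourier (Pi.single j (bp n)) x) q‖) * ∫ x, ‖G x‖ ^ 2) ≤
      2 * C * ∫ x, ‖G x‖ ^ 2 := by
    rw [mul_assoc]
    exact mul_le_mul_of_nonneg_left (mul_le_mul_of_nonneg_right (hC n hn) (integral_nonneg fun x => by positivity))
      zero_le_two
  linarith


end Summit.AnomalousDissipation.AnomalousDissipation.Theorems.SawtoothPulseCascade.K1Slot
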